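import Summits.HubbardSuperconductivity.ManyBodyBootstrap.Bounds.SdpRows2
import Summits.HubbardSuperconductivity.ManyBodyBootstrap.Bounds.E2.FourByFourAndTLRows
import Summits.HubbardSuperconductivity.ManyBodyBootstrap.Bounds.Adv1.Rows1
import Summits.HubbardSuperconductivity.HubbardLadder.Bounds.TorusRayleighUpperRows
import Summits.HubbardSuperconductivity.HubbardLadder.Bounds.WindowLowerRows
import Summits.HubbardSuperconductivity.HubbardLadder.Bounds.TorusSectorLowerRows
import Summits.HubbardSuperconductivity.HubbardLadder.Bounds.TorusDopedN14Rows
import Summits.HubbardSuperconductivity.HubbardLadder.Bounds.DerivedTLRowsTPrime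
import HarnessLib
import HarnessLib.Audit

/-!
# Many-body bootstrap — Bounds: kernel-checked CROSS-CELL LINKS between this cell's certificate claim nodes
# and the neighbouring cell pub-hubbard's INHERITED / displayed claim nodes (`HubbardLadder/Bounds`)

Cell pub-mbboot (HOME `run/shared/lean/pub/pub-mbboot/`). HONEST FRAMING: certified numerical bounds on a lattice model; not
superconductivity, not a phase diagram.

The pub-hubbard cell (`Summits/HubbardSuperconductivity/HubbardLadder/Bounds/`) types several of THIS cell's certificates as
INHERITED claim nodes in its own vocabulary (`groundEnergyAt (fermionTorusGraph 2 4) …`, `energyDensityTT' t 0 U n`), and this cell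
types the same certificates in its vocabulary (`E2.E0Upper` on `fermionRectTorusGraph 4 4`, `ThermodynamicLimit.energyDensity2D`).
The two typings were made independently by two lineages from the same certificate files. This file proves IN THE KERNEL that they
state the same proposition (or that one implies the other), so that a transcription slip in either cell would surface as a failed
`norm_num` — nothing here asserts any claim node:

* `E2.lanczos_4x4_U{2,4,6,8,12}_N16_upper ↔ HubbardLadder.Bounds.torusUpper_mbbootE2_4x4_U{…}_N16` (the five E2 `lanczos-upper-torus`
  certificates `upper_torus4x4_t1_U<U>_N16_s8_8.json`; bridge `groundEnergyAt_fermionTorusGraph_two`, dyadic constants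
  `q/2^k` written as `ℚ` literals here and as `(q : ℝ) / 2 ^ k` there);
* `E2.lucTL_U8_n1_upper ↔ HubbardLadder.Bounds.tlUpperLUC_U8_tp0_n1_inherited` (plaquette-LUC TL upper at `U = 8`, `n = 1`; bridge
  `ThermodynamicLimit.energyDensityTT'_zero`);
* `sdp_lower_TL_hubSQ_w3_U8_n7o8_R2b4eom_ob5p2 ↔ HubbardLadder.Bounds.tlLower_U8_tp0_n7o8` (pub-mbboot LADDER row 75, the `n = 7/8`
  lower endpoint of pub-hubbard's benchmark-point bracket);
* one-directional: pub-hubbard's CELL-PRODUCED PG-1 lower `tlLower_U8_tp0_n1` (`−47267352911791029154073/2⁷⁶ = −0.6255782070`)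
  implies this cell's R2 row `sdp_lower_TL_hubSQ_w3_U8_R2b4eom_ob5p2` (`−189069411663491247983629/2⁷⁸ = −0.6255782070`, weaker by
  `5.4·10⁻¹¹` — the same relaxation re-solved and re-rounded by pub-hubbard), and this cell's R3 row
  `sdp_lower_TL_hubSQ_w3_U8_R3b4eom_ob3p` (`−370495822363787989743253/2⁷⁹ = −0.6129339226`, kit j056278) implies pub-hubbard's PG-1
  lower — i.e. the R3 certificate is the stronger floor at `(U, n) = (8, 1)`.

§2 (appended): the finite-torus SECTOR rows — pub-hubbard's certificate-DATA claim nodes `torusLower_mbboot_4x4_U{2,4,6,8,12}_N16`,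
`torusLower_mbboot_4x4_U{4,8}_N14 : Nonempty (TorusSectorCertTT' …)` IMPLY (via their kernel edges `groundEnergyAt_4x4_U*_N1*_ge_of_claim`) the
typer's inequality rows `sdp_lower_4x4_U*_N16_b4eom` / `…_N14_b4eom` with the SAME constants (one direction only: an inequality does not
return the certificate data); the doped uppers `Adv1.edUpper_4x4_U4_N14 ↔ torusUpper_mbbootB2_4x4_U4_N14`, `E2.lanczos_4x4_U8_N14_upper ↔
torusUpper_mbbootE2_4x4_U8_N14`; and the plaquette-LUC thermodynamic-limit uppers `E2.lucTL_U{2,4,6,12}_n1_upper ↔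
tlUpperLUC_U{2,4,6,12}_tp0_n1_inherited` (`DerivedTLRowsTPrime.lean`).

All statements are about claim nodes BY NAME; the proofs are definitional unfolding, the two bridge lemmas and rational arithmetic
(`norm_num`). Filed by the cell's literature seat (gen 19).
-/

noncomputable section

namespace Summit.HubbardSuperconductivity.ManyBodyBootstrap.Bounds

open Literature.MathematicalPhysics.QuantumLattice Literature.MathematicalPhysics.QuantumLattice.ThermodynamicLimit
open Summit.HubbardSuperconductivity.HubbardLadder.Bounds

/-! ### The five `4×4`, `N = 16` Rayleigh uppers: E2 typing ↔ pub-hubbard's inherited typing -/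

/-- `U = 2`: E2's `lanczos_4x4_U2_N16_upper` and pub-hubbard's `torusUpper_mbbootE2_4x4_U2_N16` are the same proposition
(`2⁴⁰ = 1099511627776`). -/
theorem lanczos_4x4_U2_N16_upper_iff_torusUpper :
    E2.lanczos_4x4_U2_N16_upper ↔ torusUpper_mbbootE2_4x4_U2_N16 := by
  simp only [E2.lanczos_4x4_U2_N16_upper, E2.E0Upper, torusUpper_mbbootE2_4x4_U2_N16,
    groundEnergyAt_fermionTorusGraph_two]
  norm_num

/-- `U = 4` (`2³⁹ = 549755813888`). -/
theorem lanczos_4x4_U4_N16_upper_iff_torusUpper :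
    E2.lanczos_4x4_U4_N16_upper ↔ torusUpper_mbbootE2_4x4_U4_N16 := by
  simp only [E2.lanczos_4x4_U4_N16_upper, E2.E0Upper, torusUpper_mbbootE2_4x4_U4_N16,
    groundEnergyAt_fermionTorusGraph_two]
  norm_num

/-- `U = 6` (`2³⁶ = 68719476736`). -/
theorem lanczos_4x4_U6_N16_upper_iff_torusUpper :
    E2.lanczos_4x4_U6_N16_upper ↔ torusUpper_mbbootE2_4x4_U6_N16 := by
  simp only [E2.lanczos_4x4_U6_N16_upper, E2.E0Upper, torusUpper_mbbootE2_4x4_U6_N16,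
    groundEnergyAt_fermionTorusGraph_two]
  norm_num

/-- `U = 8` (`2³⁵ = 34359738368`). -/
theorem lanczos_4x4_U8_N16_upper_iff_torusUpper :
    E2.lanczos_4x4_U8_N16_upper ↔ torusUpper_mbbootE2_4x4_U8_N16 := by
  simp only [E2.lanczos_4x4_U8_N16_upper, E2.E0Upper, torusUpper_mbbootE2_4x4_U8_N16,
    groundEnergyAt_fermionTorusGraph_two]
  norm_num

/-- `U = 12` (`2³⁵ = 34359738368`). -/
theorem lanczos_4x4_U12_N16_upper_iff_torusUpper :
    E2.lanczos_4x4_U12_N16_upper ↔ torusUpper_mbbootE2_4x4_U12_N16 := by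
  simp only [E2.lanczos_4x4_U12_N16_upper, E2.E0Upper, torusUpper_mbbootE2_4x4_U12_N16,
    groundEnergyAt_fermionTorusGraph_two]
  norm_num

/-! ### Thermodynamic-limit rows at `U = 8`: E2 / typer typing ↔ pub-hubbard's typing -/

/-- Plaquette-LUC upper at `U = 8`, `n = 1`: E2's `lucTL_U8_n1_upper` ↔ pub-hubbard's `tlUpperLUC_U8_tp0_n1_inherited`
(`energyDensityTT' 1 0 8 1 = energyDensity2D 1 8 1`, `2³⁶ = 68719476736`). -/
theorem lucTL_U8_n1_upper_iff_tlUpperLUC :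
    E2.lucTL_U8_n1_upper ↔ tlUpperLUC_U8_tp0_n1_inherited := by
  simp only [E2.lucTL_U8_n1_upper, E2.DensityUpper, tlUpperLUC_U8_tp0_n1_inherited, energyDensityTT'_zero]
  norm_num

/-- LADDER row 75 (`U = 8`, `n = 7/8` R2 window certificate): the typer's `sdp_lower_TL_hubSQ_w3_U8_n7o8_R2b4eom_ob5p2` ↔ pub-hubbard's
inherited `tlLower_U8_tp0_n7o8` (`2⁸⁰ = 1208925819614629174706176`). -/
theorem sdp_lower_TL_hubSQ_w3_U8_n7o8_iff_tlLower :
    sdp_lower_TL_hubSQ_w3_U8_n7o8_R2b4eom_ob5p2 ↔ tlLower_U8_tp0_n7o8 := by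
  simp only [sdp_lower_TL_hubSQ_w3_U8_n7o8_R2b4eom_ob5p2, tlLower_U8_tp0_n7o8, energyDensityTT'_zero]
  norm_num

/-- pub-hubbard's cell-produced PG-1 lower (`−47267352911791029154073/2⁷⁶`) implies the typer's R2 row at `(U, n) = (8, 1)`
(`−189069411663491247983629/2⁷⁸`, weaker by `5.4·10⁻¹¹`). -/
theorem sdp_lower_TL_hubSQ_w3_U8_R2_of_tlLower (h : tlLower_U8_tp0_n1) :
    sdp_lower_TL_hubSQ_w3_U8_R2b4eom_ob5p2 := by
  simp only [sdp_lower_TL_hubSQ_w3_U8_R2b4eom_ob5p2]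
  simp only [tlLower_U8_tp0_n1, energyDensityTT'_zero] at h
  refine le_trans ?_ h
  norm_num

/-- The typer's R3 row at `(U, n) = (8, 1)` (`−370495822363787989743253/2⁷⁹ = −0.6129339`, kit j056278) implies pub-hubbard's
PG-1 lower claim `tlLower_U8_tp0_n1` (`−0.6255782`): the R3 certificate is the stronger floor. -/
theorem tlLower_U8_tp0_n1_of_sdp_lower_R3 (h : sdp_lower_TL_hubSQ_w3_U8_R3b4eom_ob3p) :
    tlLower_U8_tp0_n1 := by
  simp only [tlLower_U8_tp0_n1, energyDensityTT'_zero]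
  simp only [sdp_lower_TL_hubSQ_w3_U8_R3b4eom_ob3p] at h
  refine le_trans ?_ h
  norm_num

/-! ## §2 (lit g19, appended) — sector rows, doped uppers and the remaining LUC uppers -/

/-! ### `4×4` sector lowers: pub-hubbard's certificate-data nodes imply the typer's inequality rows (same constants) -/

/-- `U = 2`, `N = 16`: `torusLower_mbboot_4x4_U2_N16` (data) ⇒ `sdp_lower_4x4_U2_N16_b4eom` (`2⁸⁰ = 1208925819614629174706176`). -/
theorem sdp_lower_4x4_U2_N16_of_torusLower (h : torusLower_mbboot_4x4_U2_N16) : sdp_lower_4x4_U2_N16_b4eom := by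
  have h' := groundEnergyAt_4x4_U2_N16_ge_of_claim h
  rw [groundEnergyAt_fermionTorusGraph_two] at h'
  simp only [sdp_lower_4x4_U2_N16_b4eom, E₀]
  refine le_trans (le_of_eq ?_) (h'.trans_eq ?_) <;> norm_num

/-- `U = 4`, `N = 16`. -/
theorem sdp_lower_4x4_U4_N16_of_torusLower (h : torusLower_mbboot_4x4_U4_N16) : sdp_lower_4x4_U4_N16_b4eom := by
  have h' := groundEnergyAt_4x4_U4_N16_ge_of_claim h
  rw [groundEnergyAt_fermionTorusGraph_two] at h'
  simp only [sdp_lower_4x4_U4_N16_b4eom, E₀]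
  refine le_trans (le_of_eq ?_) (h'.trans_eq ?_) <;> norm_num

/-- `U = 6`, `N = 16`. -/
theorem sdp_lower_4x4_U6_N16_of_torusLower (h : torusLower_mbboot_4x4_U6_N16) : sdp_lower_4x4_U6_N16_b4eom := by
  have h' := groundEnergyAt_4x4_U6_N16_ge_of_claim h
  rw [groundEnergyAt_fermionTorusGraph_two] at h'
  simp only [sdp_lower_4x4_U6_N16_b4eom, E₀]
  refine le_trans (le_of_eq ?_) (h'.trans_eq ?_) <;> norm_num

/-- `U = 8`, `N = 16` (`2⁷⁹ = 604462909807314587353088`). -/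
theorem sdp_lower_4x4_U8_N16_of_torusLower (h : torusLower_mbboot_4x4_U8_N16) : sdp_lower_4x4_U8_N16_b4eom := by
  have h' := groundEnergyAt_4x4_U8_N16_ge_of_claim h
  rw [groundEnergyAt_fermionTorusGraph_two] at h'
  simp only [sdp_lower_4x4_U8_N16_b4eom, E₀]
  refine le_trans (le_of_eq ?_) (h'.trans_eq ?_) <;> norm_num

/-- `U = 12`, `N = 16` (`2⁷⁷ = 151115727451828646838272`). -/
theorem sdp_lower_4x4_U12_N16_of_torusLower (h : torusLower_mbboot_4x4_U12_N16) : sdp_lower_4x4_U12_N16_b4eom := by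
  have h' := groundEnergyAt_4x4_U12_N16_ge_of_claim h
  rw [groundEnergyAt_fermionTorusGraph_two] at h'
  simp only [sdp_lower_4x4_U12_N16_b4eom, E₀]
  refine le_trans (le_of_eq ?_) (h'.trans_eq ?_) <;> norm_num

/-- `U = 4`, `N = 14` (`2⁷⁸ = 302231454903657293676544`). -/
theorem sdp_lower_4x4_U4_N14_of_torusLower (h : torusLower_mbboot_4x4_U4_N14) : sdp_lower_4x4_U4_N14_b4eom := by
  have h' := groundEnergyAt_4x4_U4_N14_ge_of_claim h
  rw [groundEnergyAt_fermionTorusGraph_two] at h'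
  simp only [sdp_lower_4x4_U4_N14_b4eom, E₀]
  refine le_trans (le_of_eq ?_) (h'.trans_eq ?_) <;> norm_num

/-- `U = 8`, `N = 14` (`2⁸⁰`). -/
theorem sdp_lower_4x4_U8_N14_of_torusLower (h : torusLower_mbboot_4x4_U8_N14) : sdp_lower_4x4_U8_N14_b4eom := by
  have h' := groundEnergyAt_4x4_U8_N14_ge_of_claim h
  rw [groundEnergyAt_fermionTorusGraph_two] at h'
  simp only [sdp_lower_4x4_U8_N14_b4eom, E₀]
  refine le_trans (le_of_eq ?_) (h'.trans_eq ?_) <;> norm_num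

/-! ### Doped (`N = 14`) Rayleigh uppers: adv-1 / E2 typing ↔ pub-hubbard's inherited typing -/

/-- `U = 4`, `N = 14`: adv-1's `edUpper_4x4_U4_N14` ↔ `torusUpper_mbbootB2_4x4_U4_N14` (`2³⁹ = 549755813888`). -/
theorem edUpper_4x4_U4_N14_iff_torusUpper :
    Adv1.edUpper_4x4_U4_N14 ↔ torusUpper_mbbootB2_4x4_U4_N14 := by
  simp only [Adv1.edUpper_4x4_U4_N14, E2.E0Upper, torusUpper_mbbootB2_4x4_U4_N14, groundEnergyAt_fermionTorusGraph_two]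
  norm_num

/-- `U = 8`, `N = 14`: E2's `lanczos_4x4_U8_N14_upper` ↔ `torusUpper_mbbootE2_4x4_U8_N14` (`2³⁶ = 68719476736`). -/
theorem lanczos_4x4_U8_N14_upper_iff_torusUpper :
    E2.lanczos_4x4_U8_N14_upper ↔ torusUpper_mbbootE2_4x4_U8_N14 := by
  simp only [E2.lanczos_4x4_U8_N14_upper, E2.E0Upper, torusUpper_mbbootE2_4x4_U8_N14, groundEnergyAt_fermionTorusGraph_two]
  norm_num

/-! ### Plaquette-LUC thermodynamic-limit uppers at `U = 2, 4, 6, 12` (the `U = 8` one is in §1) -/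

/-- `U = 2`: `E2.lucTL_U2_n1_upper ↔ tlUpperLUC_U2_tp0_n1_inherited` (`2³⁶`). -/
theorem lucTL_U2_n1_upper_iff_tlUpperLUC :
    E2.lucTL_U2_n1_upper ↔ tlUpperLUC_U2_tp0_n1_inherited := by
  simp only [E2.lucTL_U2_n1_upper, E2.DensityUpper, tlUpperLUC_U2_tp0_n1_inherited, energyDensityTT'_zero]
  norm_num

/-- `U = 4` (`2³⁵ = 34359738368`). -/
theorem lucTL_U4_n1_upper_iff_tlUpperLUC :
    E2.lucTL_U4_n1_upper ↔ tlUpperLUC_U4_tp0_n1_inherited := by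
  simp only [E2.lucTL_U4_n1_upper, E2.DensityUpper, tlUpperLUC_U4_tp0_n1_inherited, energyDensityTT'_zero]
  norm_num

/-- `U = 6` (`2³⁶`). -/
theorem lucTL_U6_n1_upper_iff_tlUpperLUC :
    E2.lucTL_U6_n1_upper ↔ tlUpperLUC_U6_tp0_n1_inherited := by
  simp only [E2.lucTL_U6_n1_upper, E2.DensityUpper, tlUpperLUC_U6_tp0_n1_inherited, energyDensityTT'_zero]
  norm_num

/-- `U = 12` (`2³³ = 8589934592`). -/
theorem lucTL_U12_n1_upper_iff_tlUpperLUC :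
    E2.lucTL_U12_n1_upper ↔ tlUpperLUC_U12_tp0_n1_inherited := by
  simp only [E2.lucTL_U12_n1_upper, E2.DensityUpper, tlUpperLUC_U12_tp0_n1_inherited, energyDensityTT'_zero]
  norm_num

end Summit.HubbardSuperconductivity.ManyBodyBootstrap.Bounds

end
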